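import Literature.MathematicalPhysics.QuantumFieldTheory.Balaban1983to89.B7Prop1Explicit
import HarnessLib

/-!
# `UnitScaleTiltProp7CornerCombFlatStructure` — the CLOSED FORM of the `k`-fold cornered comb average at first order, flat abelian
(«COMB⁽ᵏ⁾ = STRAIGHT⁽ᵏ⁾ + d(corner-restricted sum over scales of comb-trees of straight averages)»)

«(O2) groundwork — not consumed by any displayed row before the freeze lifts» (★★OWNER ym3-torus-plan g29 RULINGS №19 (O2),
№20 (2), №22 (c); «(II) GO» of record 2026-08-29T06:31:31Z; pen II-1 named by ★routeR-w1 g9 06:35:17Z).  Crux 19200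
`MinimiserStabilityRegPr`, route-R E′ (A′)-on-Σ, P-A2 (β) lane, supplier design (II) «COMB = STRAIGHT ∘ BLOCK-AXIAL» for the labelled
route-internal row `hMcomb` (★routeR-w6 g8 SIGNATURE-0 2f7f2fca).  This file is the FLAT-LINEAR STRUCTURE THEOREM of record (LEMMA A of
`ym-routeR-w4/g16/DESIGN-II-FLATCORE-routeRw4g16.md` 85b2c314 = §0 of `ym-routeR-w6/PREREAD-II-STRUCTURE-routeRw6g8.md` 6d5726a1, re-derived
independently in `ym-routeR-w1/DESIGN-N3COMB-LINEAR-CORE-routeRw1g9.md` 6efb31c3; verified in exact rational arithmetic by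
`ym-routeR-w4/g16/num/lemmaA.py` for `(L,k) ∈ {(2,3),(2,4),(3,2),(3,3),(4,2)}` and numerically to `10⁻¹⁵` by `ym-routeR-w6/num/structure_check.py`).

THE OBJECTS (all in the letters of lit `B7Prop1Explicit`: `asum` = the abelian path functional `A(Γ)` (p. 24), `gammaWord L κ r =
treeWord r ++ seg κ L ++ revWord (treeWord r)` = the contour `Γ_{c,x}` of (14) p. 19 based at the CORNER `q` of the block, `boxVec`,
`treeWord`, `seg`, `e`, `disp`).  Three families, bound by RECURSION HYPOTHESES (the ✓`Prop7CurvedLandauRowA` text pattern — no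
definition is introduced):
* `B : ℕ → Site d → Fin d → 𝔸`, `B (m+1) z κ = Σ_{r ∈ [0,L)ᵈ} L⁻ᵈ • asum (B m) (L•z) (gammaWord L κ r)` — the linearisation at `V = 1` of
  print's one-step average (42) [Balaban1985Averaging] (`V̄_c = exp[Σ_x L⁻ᵈ log V(Γ_{c,x})V(c)⁻¹]·V(c)`, lit `bavg`; to first order in `A`,
  `log` and `exp` drop and the weights sum to one, lit `sum_weights`), iterated with `rescale` (lit `avgIter`): `B m = ` the `m`-fold
  linearised CORNERED COMB average of `B 0` (the flat-member, first-order shadow of `tildIter L 1 (e^{εA}) m`, cf. ✓`Prop7CombTildTrueLin`);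
* `S : ℕ → Site d → Fin d → 𝔸`, `S 0 = B 0`, `S (m+1) z κ = Σ_r L⁻ᵈ • asum (S m) (L•z + r) (seg κ L)` — the STRAIGHT tower (print's
  (125) main term `Q₀`, lit `B7Prop3GeneralLinear.Q0cov` at trivial transporters, iterated);
* `D : ℕ → Site d → 𝔸`, `D m y = Σ_r L⁻ᵈ • asum (S m) y (treeWord r)` — the COMB-TREE OF STRAIGHT AVERAGES at scale `m` hung at the
  level-`m` site `y` (= ★routeR-w6's charge `m_m(y)`, ★routeR-w4's `D⁽ᵐ⁾@y`).
THE THEOREM (★★★`cornerComb_flat_structure`): for every `k`, `z`, `κ`,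
  `B k z κ = S k z κ + Σ_{m<k} ( D m (L^{k−m} • z) − D m (L^{k−m} • (z + e κ)) )`.
I.e. the `k`-fold cornered comb functional of the level-`k` bond `(z,κ)` is the uniform straight slab average plus, hung at each of the two
CORNERS `Lᵏ•z`, `Lᵏ•(z + e_κ)` of the bond, one comb-tree of straight averages per scale `m < k` — no comb mean, no coarse gauge, no
recursion on norms.  (The cornered blocks are NESTED WITH COMMON CORNERS: a level-`k` corner is a level-`m` corner for every `m ≤ k`;
this is what makes the closed form possible.)

PROOF (shorter than the chain bookkeeping of the memos): write the induction hypothesis as «`B k = S k − dθ_k`» with the SITE function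
`θ_k w := Σ_{m<k} D m (L^{k−m}•w)`; ONE lemma — the abelian path functional of an exact 1-form telescopes, ★`asum_sub_shift` — then does both
telescopings (along the straight run and along the tree) at once; `disp (gammaWord L κ r) = L•e κ` (lit `disp_gammaWord`) makes the `θ`-part
independent of `r`, `Σ_r L⁻ᵈ = 1` (lit `sum_weights`) collapses it, and `asum_gammaWord` (lit) splits the `S k`-part into
`S (k+1) + D k (L•z) − D k (L•z + L•e κ)`; finally `θ_{k+1} w = θ_k (L•w) + D k (L•w)` is `Finset.sum_range_succ`.

Generality: any dimension `d`, any `L ≥ 1`, any normed ring `𝔸` with an `ℝ`-module structure (matrix algebras, C⋆-algebras through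
`Module.complexToReal`); no smallness, no background.  Consumers: II-2 (the A-slot Jensen bound for `S`), ★routeR-w1's F-4∕F-5 (the dressed
structure theorem tests against this flat certificate), ★routeR-w6's II-3 (the corner pieces `D m` are what the scale telescoping prices).
HONEST: a finite-sum identity; nothing of `hMcomb` ∕ `hMcomb₂` ∕ (β) ∕ `hD` ∕ the crux 19200 is proved or claimed; rung R3 (YM₃ on T³), not
d = 4, not infinite volume, not a mass gap, not Clay.
-/

open scoped BigOperators
open Finset
open Literature.MathematicalPhysics.QuantumFieldTheory.Balaban1983to89.B7Prop1Explicit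

namespace Summit.QuantumFields.YangMills.Theorems.Prop7CornerCombFlatStructure

variable {d : ℕ} {𝔸 : Type*} [NormedRing 𝔸]

/-! ## §1 Linearity of the abelian path functional `asum` in the field (additivity: a private local copy of ✓`NE3TangentNoGoFlat.asum_add'`), and exactness on gradients -/

section AsumLinear

/-- `A(Γ)` is additive in the field (pointwise sum of two bond functions); a local copy of ✓`NE3TangentNoGoFlat.asum_add'`
kept private so that this file's import closure stays inside {Mathlib, Literature, YangMills}. [folklore] -/
private theorem asum_add_loc (A G : Site d → Fin d → 𝔸) :
    ∀ (x : Site d) (w : List (Letter d)), asum (fun y μ => A y μ + G y μ) x w = asum A x w + asum G x w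
  | x, [] => by simp
  | x, l :: w => by
    rw [asum_cons, asum_cons, asum_cons, asum_add_loc A G (x + l.vec) w]
    obtain ⟨μ, b⟩ := l
    cases b <;> simp only [stepA, Bool.false_eq_true, ↓reduceIte, neg_add] <;> abel

/-- `A(Γ)` commutes with real scalars on the field. [folklore] -/
theorem asum_smul_field [Module ℝ 𝔸] (c : ℝ) (A : Site d → Fin d → 𝔸) :
    ∀ (x : Site d) (w : List (Letter d)), asum (fun y μ => c • A y μ) x w = c • asum A x w
  | x, [] => by simp
  | x, l :: w => by
    rw [asum_cons, asum_cons, asum_smul_field c A (x + l.vec) w, smul_add]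
    obtain ⟨μ, b⟩ := l
    cases b <;> simp only [stepA, Bool.false_eq_true, ↓reduceIte, smul_neg]

/-- `A(Γ)` of a finite sum of fields is the sum of the `A_i(Γ)`. [folklore] -/
theorem asum_finset_sum_field {ι : Type*} (s : Finset ι) (A : ι → Site d → Fin d → 𝔸) (x : Site d) (w : List (Letter d)) :
    asum (fun y μ => ∑ i ∈ s, A i y μ) x w = ∑ i ∈ s, asum (A i) x w := by
  classical
  induction s using Finset.induction_on with
  | empty =>
    simp only [Finset.sum_empty]
    induction w generalizing x with
    | nil => simp
    | cons l w ih =>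
      rw [asum_cons, ih]
      obtain ⟨μ, b⟩ := l
      cases b <;> simp [stepA]
  | insert i s hi ih =>
    simp only [Finset.sum_insert hi]
    rw [← ih, ← asum_add_loc]

/-- **EXACTNESS: the abelian path functional of a (backward) exact 1-form telescopes to the endpoints.**  For a site function `θ` and the bond
function `G(y, μ) := θ(y) − θ(y + e_μ)`: `asum G x w = θ(x) − θ(x + disp w)` for every word `w` (both letter orientations).  This is the flat
abelian case of print's gauge covariance (45)∕(11) [Balaban1985Averaging] linearised (cf. ✓`Prop7CombTildPureGauge.tsum_covGrad` at a
curved background); here it does ALL the telescoping of the structure theorem. [folklore] [cite: Balaban1985Averaging, (45) p.24] -/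
theorem asum_sub_shift (θ : Site d → 𝔸) :
    ∀ (x : Site d) (w : List (Letter d)), asum (fun y μ => θ y - θ (y + e μ)) x w = θ x - θ (x + disp w)
  | x, [] => by simp
  | x, l :: w => by
    rw [asum_cons, asum_sub_shift θ (x + l.vec) w, disp_cons, ← add_assoc]
    obtain ⟨μ, b⟩ := l
    cases b
    · -- backward letter: `stepA = −G(x − e_μ, μ) = −(θ(x − e_μ) − θ(x))`, `vec = −e_μ`
      simp only [stepA, Bool.false_eq_true, ↓reduceIte, Letter.vec_false]
      rw [show x + -e μ + e μ = x by abel]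
      abel
    · -- forward letter: `stepA = G(x, μ) = θ(x) − θ(x + e_μ)`, `vec = e_μ`
      simp only [stepA, ↓reduceIte, Letter.vec_true]
      abel

end AsumLinear

/-! ## §2 The structure theorem -/

section Structure

variable [Module ℝ 𝔸]

/-- One scale of the corner sum, re-based: for `m < k`, `L^{k+1−m} • w = L^{k−m} • (L • w)` on lattice sites. [folklore] -/
theorem pow_succ_sub_smul (L : ℕ) {k m : ℕ} (hm : m < k + 1) (w : Site d) :
    ((L : ℤ) ^ (k + 1 - m)) • w = ((L : ℤ) ^ (k - m)) • ((L : ℤ) • w) := by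
  rw [show k + 1 - m = k - m + 1 by omega, pow_succ, mul_smul]

/-- ★★★ **THE CLOSED FORM OF THE `k`-FOLD CORNERED COMB AVERAGE AT FIRST ORDER (flat, abelian; any `d`, any `L ≥ 1`).**  Let `B` be the tower
of linearised cornered comb averages (42)∕(43) of a fine bond field `B 0` (`B (m+1) z κ = Σ_r L⁻ᵈ • asum (B m) (L•z) (gammaWord L κ r)`),
`S` the straight tower (`S 0 = B 0`, `S (m+1) z κ = Σ_r L⁻ᵈ • asum (S m) (L•z + r) (seg κ L)`) and `D m y = Σ_r L⁻ᵈ • asum (S m) y (treeWord r)`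
the comb-tree of level-`m` straight averages hung at the level-`m` site `y`.  Then for every `k`, `z`, `κ`:
`B k z κ = S k z κ + Σ_{m<k} ( D m (L^{k−m} • z) − D m (L^{k−m} • (z + e κ)) )`.
«(O2) groundwork — not consumed by any displayed row before the freeze lifts.»
[cite: Balaban1985Averaging, (42)-(43) pp.23-24, (14) p.19, (125) p.36] -/
theorem cornerComb_flat_structure (L : ℕ) (hL : 1 ≤ L) (B S : ℕ → Site d → Fin d → 𝔸) (D : ℕ → Site d → 𝔸)
    (hB : ∀ (m : ℕ) (z : Site d) (κ : Fin d),
      B (m + 1) z κ = ∑ r : Fin d → Fin L, (((L : ℝ) ^ d)⁻¹) • asum (B m) ((L : ℤ) • z) (gammaWord L κ (boxVec L r)))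
    (hS0 : ∀ (z : Site d) (κ : Fin d), S 0 z κ = B 0 z κ)
    (hS : ∀ (m : ℕ) (z : Site d) (κ : Fin d),
      S (m + 1) z κ = ∑ r : Fin d → Fin L, (((L : ℝ) ^ d)⁻¹) • asum (S m) ((L : ℤ) • z + boxVec L r) (seg κ (L : ℤ)))
    (hD : ∀ (m : ℕ) (y : Site d), D m y = ∑ r : Fin d → Fin L, (((L : ℝ) ^ d)⁻¹) • asum (S m) y (treeWord (boxVec L r)))
    (k : ℕ) (z : Site d) (κ : Fin d) :
    B k z κ = S k z κ + ∑ m ∈ Finset.range k, (D m (((L : ℤ) ^ (k - m)) • z) - D m (((L : ℤ) ^ (k - m)) • (z + e κ))) := by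
  induction k generalizing z κ with
  | zero => simp [hS0]
  | succ k ih =>
    -- the site function `θ_k` and the induction hypothesis in the form `B k = S k − dθ_k`
    set θ : Site d → 𝔸 := fun w => ∑ m ∈ Finset.range k, D m (((L : ℤ) ^ (k - m)) • w) with hθ
    have hIH : ∀ (w : Site d) (κ' : Fin d), B k w κ' = S k w κ' + (θ w - θ (w + e κ')) := by
      intro w κ'
      rw [ih w κ', hθ]
      simp only [Finset.sum_sub_distrib]
    have hBk : B k = fun w κ' => S k w κ' + (θ w - θ (w + e κ')) := funext fun w => funext fun κ' => hIH w κ'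
    -- the weights sum to one
    have hw : ∑ _r : Fin d → Fin L, (((L : ℝ) ^ d)⁻¹ : ℝ) = 1 := sum_weights L hL
    -- `θ_{k+1} w = θ_k (L•w) + D k (L•w)`
    have hθ' : ∀ w : Site d, ∑ m ∈ Finset.range (k + 1), D m (((L : ℤ) ^ (k + 1 - m)) • w)
        = θ ((L : ℤ) • w) + D k ((L : ℤ) • w) := by
      intro w
      rw [Finset.sum_range_succ, hθ, show k + 1 - k = 1 by omega, pow_one]
      congr 1
      refine Finset.sum_congr rfl fun m hm => ?_
      rw [pow_succ_sub_smul L (by have := Finset.mem_range.mp hm; omega) w]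
    -- the right-hand side: `θ_{k+1}` at the two corners
    rw [Finset.sum_sub_distrib, hθ' z, hθ' (z + e κ)]
    -- expand one step of the comb tower and insert the induction hypothesis
    rw [hB k z κ, hBk]
    have hsplit : ∀ r : Fin d → Fin L,
        asum (fun w κ' => S k w κ' + (θ w - θ (w + e κ'))) ((L : ℤ) • z) (gammaWord L κ (boxVec L r))
          = (asum (S k) ((L : ℤ) • z) (treeWord (boxVec L r))
              + asum (S k) ((L : ℤ) • z + boxVec L r) (seg κ (L : ℤ))
              - asum (S k) ((L : ℤ) • z + (L : ℤ) • e κ) (treeWord (boxVec L r)))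
            + (θ ((L : ℤ) • z) - θ ((L : ℤ) • z + (L : ℤ) • e κ)) := by
      intro r
      rw [asum_add_loc, asum_sub_shift, disp_gammaWord, asum_gammaWord]
    simp only [hsplit, smul_add, Finset.sum_add_distrib, ← Finset.sum_smul, hw, one_smul, smul_sub, Finset.sum_sub_distrib]
    rw [← hS k z κ, ← hD k ((L : ℤ) • z), ← hD k ((L : ℤ) • z + (L : ℤ) • e κ)]
    abel

/-- ★★ **The same, with the corner sum packaged as a site potential** `Θ_k w := Σ_{m<k} D m (L^{k−m}•w)`: the `k`-fold cornered comb
functional is the straight functional minus the coarse GRADIENT of `Θ_k` across the bond — so it pairs gauge-exactly and its comb-specific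
part is blind to covariantly constant (here: constant) fields level by level (`D m` of a constant is the same at both corners).
[cite: Balaban1985Averaging, (42)-(43) pp.23-24] -/
theorem cornerComb_flat_structure_potential (L : ℕ) (hL : 1 ≤ L) (B S : ℕ → Site d → Fin d → 𝔸) (D : ℕ → Site d → 𝔸)
    (hB : ∀ (m : ℕ) (z : Site d) (κ : Fin d),
      B (m + 1) z κ = ∑ r : Fin d → Fin L, (((L : ℝ) ^ d)⁻¹) • asum (B m) ((L : ℤ) • z) (gammaWord L κ (boxVec L r)))
    (hS0 : ∀ (z : Site d) (κ : Fin d), S 0 z κ = B 0 z κ)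
    (hS : ∀ (m : ℕ) (z : Site d) (κ : Fin d),
      S (m + 1) z κ = ∑ r : Fin d → Fin L, (((L : ℝ) ^ d)⁻¹) • asum (S m) ((L : ℤ) • z + boxVec L r) (seg κ (L : ℤ)))
    (hD : ∀ (m : ℕ) (y : Site d), D m y = ∑ r : Fin d → Fin L, (((L : ℝ) ^ d)⁻¹) • asum (S m) y (treeWord (boxVec L r)))
    (Θ : ℕ → Site d → 𝔸) (hΘ : ∀ (k : ℕ) (w : Site d), Θ k w = ∑ m ∈ Finset.range k, D m (((L : ℤ) ^ (k - m)) • w))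
    (k : ℕ) (z : Site d) (κ : Fin d) :
    B k z κ = S k z κ + (Θ k z - Θ k (z + e κ)) := by
  rw [cornerComb_flat_structure L hL B S D hB hS0 hS hD k z κ, hΘ, hΘ, Finset.sum_sub_distrib]

end Structure

end Summit.QuantumFields.YangMills.Theorems.Prop7CornerCombFlatStructure
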